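import Mathlib
import Literature.NumberTheory.Irrationality.Brown2016.DinnerParties
import Summits.KontsevichZagierPeriods.Zeta5Search.Families.ConfigurationsEight
import Summits.KontsevichZagierPeriods.Zeta5Search.Families.ConfigurationsNineCompleteC
import Summits.KontsevichZagierPeriods.Zeta5Search.Families.ConfigurationsTenConvergent
import Summits.KontsevichZagierPeriods.Zeta5Search.Families.ConfigurationsTenComplete
import Summits.KontsevichZagierPeriods.Zeta5Search.Families.ConvergentClasses
import HarnessLib

/-!
# ζ(5) search — Families: the configuration lists `reps5 … reps10` describe the convergent seatings EXACTLY

HONEST FRAMING: systematic search; no irrationality claim unless certified.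

Cell `pub-zeta5`, seat P2.  Putting together, for each `5 ≤ N ≤ 10`, (i) the kernel-checked convergence of every listed
representative (`isConvergent_repsN`), (ii) the kernel-checked completeness "every convergent seating is equivalent to a
listed one" (`complete_repsN`: Brown2016 for `N ≤ 7`, `Families/ConfigurationsEight`, `…NineCompleteC`, `…TenComplete`),
and (iii) the THEOREM that convergence is constant on Brown's equivalence classes
(`Families/ConvergentClasses.isConvergent_iff_of_equivalent`):
**for a seating plan `σ` of `N` guests, `IsConvergent N σ ↔ ∃ τ ∈ repsN, Equivalent N σ τ`** — the printed
(`N ≤ 8`, [Brown2016, App. 2 §10.1]) and enumerated (`N = 9, 10`, this cell) lists ARE the convergent seating plans up to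
`D_{2N} × D_{2N}`, i.e. exactly the index set of Brown's basic cellular integrals that pass his convergence test
(`Families/ConvergentSeating.brownConvergent_basic_ofSeating_iff`).  Counts: `𝒞₅ = 𝒞₆ = 1`, `𝒞₇ = 5`, `𝒞₈ = 17`,
`𝒞₉ = 105`, `𝒞₁₀ = 771` [Brown2016, App. 2 §10.1].  Combined with Lemma 3.6 (`brownConvergent_basic_ofSeating_iff`):
`brownConvergent_basic_eight/nine/ten_iff_exists_repsN` — a seating plan's basic integrand passes Brown's convergence test
(`M ≥ 0`) iff the plan is equivalent to a listed configuration.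
-/

namespace Summit.KontsevichZagierPeriods.Zeta5Search.Families.Cellular

open Literature.NumberTheory.Irrationality.Brown2016

/-! ### The configuration lists as EXACT descriptions of the convergent seatings -/

/-- **`N = 5, 6, 7`** (Brown's printed lists `reps5`, `reps6`, `reps7`): a seating plan is convergent iff it is equivalent
to a listed configuration. [Brown2016, App. 2 §10.1.1–10.1.3] -/
theorem isConvergent_five_iff_exists_reps5 {σ : List ℕ} (hσ : IsSeating 5 σ) :
    IsConvergent 5 σ ↔ ∃ τ ∈ reps5, Equivalent 5 σ τ :=
  ⟨complete_reps5 σ hσ, fun ⟨τ, hτ, he⟩ =>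
    (isConvergent_iff_of_equivalent (ℓ := 2) hσ he).2 (isConvergent_reps5 τ hτ)⟩

/-- `N = 6`. [Brown2016, App. 2 §10.1.2] -/
theorem isConvergent_six_iff_exists_reps6 {σ : List ℕ} (hσ : IsSeating 6 σ) :
    IsConvergent 6 σ ↔ ∃ τ ∈ reps6, Equivalent 6 σ τ :=
  ⟨complete_reps6 σ hσ, fun ⟨τ, hτ, he⟩ =>
    (isConvergent_iff_of_equivalent (ℓ := 3) hσ he).2 (isConvergent_reps6 τ hτ)⟩

/-- `N = 7`. [Brown2016, App. 2 §10.1.3] -/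
theorem isConvergent_seven_iff_exists_reps7 {σ : List ℕ} (hσ : IsSeating 7 σ) :
    IsConvergent 7 σ ↔ ∃ τ ∈ reps7, Equivalent 7 σ τ :=
  ⟨complete_reps7 σ hσ, fun ⟨τ, hτ, he⟩ =>
    (isConvergent_iff_of_equivalent (ℓ := 4) hσ he).2 (isConvergent_reps7 τ hτ)⟩

/-- All `N = 8` representatives are seating plans. -/
theorem isSeating_reps8 : ∀ τ ∈ reps8, IsSeating 8 τ := by decide

/-- **`N = 8`**: a seating plan of eight guests is convergent iff it is equivalent to one of Brown's seventeen
printed configurations. [Brown2016, App. 2 §10.1.4] -/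
theorem isConvergent_eight_iff_exists_reps8 {σ : List ℕ} (hσ : IsSeating 8 σ) :
    IsConvergent 8 σ ↔ ∃ τ ∈ reps8, Equivalent 8 σ τ := by
  refine ⟨Configurations.complete_reps8 σ hσ, ?_⟩
  rintro ⟨τ, hτ, he⟩
  exact (isConvergent_iff_of_equivalent (ℓ := 5) hσ he).2 (isConvergent_reps8 τ hτ)

/-- **`N = 9`**: a seating plan of nine guests is convergent iff it is equivalent to one of the 105 listed
configurations `Configurations.reps9`. [Brown2016, App. 2 §10.1 (`𝒞₉ = 105`)] -/
theorem isConvergent_nine_iff_exists_reps9 {σ : List ℕ} (hσ : IsSeating 9 σ) :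
    IsConvergent 9 σ ↔ ∃ τ ∈ Configurations.reps9, Equivalent 9 σ τ := by
  refine ⟨Configurations.complete_reps9 σ hσ, ?_⟩
  rintro ⟨τ, hτ, he⟩
  exact (isConvergent_iff_of_equivalent (ℓ := 6) hσ he).2 (Configurations.isConvergent_reps9 τ hτ)

/-- **`N = 10`**: a seating plan of ten guests is convergent iff it is equivalent to one of the 771 listed
configurations `Cells.ConfigurationsTen.reps10`. [Brown2016, App. 2 §10.1 (`𝒞₁₀ = 771`)] -/
theorem isConvergent_ten_iff_exists_reps10 {σ : List ℕ} (hσ : IsSeating 10 σ) :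
    IsConvergent 10 σ ↔ ∃ τ ∈ Cells.ConfigurationsTen.reps10, Equivalent 10 σ τ := by
  refine ⟨Configurations.complete_reps10 σ hσ, ?_⟩
  rintro ⟨τ, hτ, he⟩
  exact (isConvergent_iff_of_equivalent (ℓ := 7) hσ he).2 (Configurations.isConvergent_reps10 τ hτ)

/-! ### … and therefore EXACTLY the index set of Brown-convergent basic cellular integrands -/

/-- `N = 8`: for a seating plan `σ` of eight guests and any `M ≥ 0`, the basic cellular integrand `f_σ^M ω_σ` passes
Brown's convergence test iff `σ` is equivalent to one of the seventeen printed configurations.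
[Brown2016, Lemma 3.6, App. 2 §10.1.4] -/
theorem brownConvergent_basic_eight_iff_exists_reps8 {σ : List ℕ} (hσ : IsSeating 8 σ) {M : ℤ} (hM : 0 ≤ M) :
    BrownConvergent (ofSeating (ℓ := 5) σ) (fun _ => M) (fun _ => M) ↔ ∃ τ ∈ reps8, Equivalent 8 σ τ := by
  rw [brownConvergent_basic_ofSeating_iff (ℓ := 5) hσ hM, isConvergent_eight_iff_exists_reps8 hσ]

/-- `N = 9`: the same with the 105 classes `Configurations.reps9`. [Brown2016, Lemma 3.6, App. 2 §10.1] -/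
theorem brownConvergent_basic_nine_iff_exists_reps9 {σ : List ℕ} (hσ : IsSeating 9 σ) {M : ℤ} (hM : 0 ≤ M) :
    BrownConvergent (ofSeating (ℓ := 6) σ) (fun _ => M) (fun _ => M) ↔
      ∃ τ ∈ Configurations.reps9, Equivalent 9 σ τ := by
  rw [brownConvergent_basic_ofSeating_iff (ℓ := 6) hσ hM, isConvergent_nine_iff_exists_reps9 hσ]

/-- `N = 10`: the same with the 771 classes `Cells.ConfigurationsTen.reps10`. [Brown2016, Lemma 3.6, App. 2 §10.1] -/
theorem brownConvergent_basic_ten_iff_exists_reps10 {σ : List ℕ} (hσ : IsSeating 10 σ) {M : ℤ} (hM : 0 ≤ M) :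
    BrownConvergent (ofSeating (ℓ := 7) σ) (fun _ => M) (fun _ => M) ↔
      ∃ τ ∈ Cells.ConfigurationsTen.reps10, Equivalent 10 σ τ := by
  rw [brownConvergent_basic_ofSeating_iff (ℓ := 7) hσ hM, isConvergent_ten_iff_exists_reps10 hσ]

end Summit.KontsevichZagierPeriods.Zeta5Search.Families.Cellular
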